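/-
Copyright: the b2b-balaban T⁴-continuum CRUX team, row NE7b OWNER lineage `t4-ne7b-p1` (gen 139). Project licence.
-/
import Summits.QuantumFields.BalabanUV.T4Continuum.Spine.NE7b.SupOneSiteResamplingInvariance
import Summits.QuantumFields.BalabanUV.T4Continuum.Spine.NE7b.SupDobrushinCovarianceAbstract

/-!
# DOBRUSHIN'S COVARIANCE ESTIMATE FOR A LOG-CONCAVE GIBBS LAW ON `ℝ^ι`, IN KERNEL LETTERS (SCOPING (d10)(2) — THE COVARIANCE KERNEL
# LETTER, PROVED): let `V : ℝ^ι → ℝ` be continuous with partial derivatives `∂_xV` along every coordinate line, DIAGONAL FLOOR `c_x > 0`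
# and ceiling (secant form along the line), CROSS LETTERS `|∂_xV(ω^{z,s}) − ∂_xV(ω^{z,t})| ≤ J_{xz}|s−t|` (`J ≥ 0`, `J_{xx} = 0`),
# ROW-DIAGONAL DOMINANCE `Σ_z J_{xz}∕c_x ≤ γ < 1`, and the moment letters `e^{−V}, ω_z²e^{−V} ∈ L¹`. Then under the Gibbs probability law
# `ν = e^{−V}dω∕∫e^{−V}`, two observables `F, G` with coordinate-Lipschitz vectors `a, b` satisfy, for every nonnegative `D` with
# `I + D·C ≤ D` (`C_{xz} = J_{xz}∕c_x`),
#   `|∫FG dν − ∫F dν·∫G dν| ≤ Σ_w (Dᵀa)_w·(Dᵀb)_w ∕ c_w`,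
# and a FAMILY `G_y` with vectors `b^y` whose columns are summable (`Σ_y b^y_z ≤ κc`) gives the ROW-SUM (kernel) letter
#   `Σ_y |Cov_ν(F, G_y)| ≤ (Σ_z a_z)·κc·dr·dc ∕ cmin`   (`Σ_wD_{zw} ≤ dr`, `Σ_zD_{zw} ≤ dc`, `c_w ≥ cmin`)
# — Föllmer's estimate, uniformly in the volume `|ι|`; the single-site Gibbs sampler (445)∕(446) feeds the abstract theorem (442)
# (row NE7b, node U5c; (442), (445), (446) BY NAME; [folklore] — Dobrushin 1970, Föllmer 1982 ∕ LNM 1362 Thm (2.23))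

Cell `pub-balaban`, sub-cell `t4`, spine estimate NE7b (`T4WeightBudget.RelWeightBound`; the cell's OWN estimate — NOT PRINTED in
[Bałaban 1983–89], NOT PROVED).  Crux-route work under `Spine/NE7b/` by the row OWNER (`t4-ne7b-p1` gen 139, file (447)) under FREEZE
(0)'s crux-prover clause; NOTHING of Bałaban's is named as a Lean object, valued or asserted; no `T4Continuum/Support` leaf typed; no
`def`, no notation (the sampler `P` is hypothesis-characterised, `hP`); zero `sorry`.  Imports (BY NAME): the OWNER's (446)
`…SupOneSiteResamplingInvariance` (`resample_integral`, `resample_cov_step`, `memLp_coord_tilted`), (445) (`resample_lipVec`), (442)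
`…SupDobrushinCovarianceAbstract` (`abs_cov_le_kernel`); Mathlib's `Measure.tilted`.

WHAT IS PROVED ([folklore]):
* §1 the Gibbs law `ν = volume.tilted (−V)`: `integral_tilted_eq` (`∫g dν = ∫ge^{−V}∕∫e^{−V}`), `resample_integral_tilted` ((P2) for `ν`),
  `resample_cov_step_tilted` ((P3) for `ν`: `|∫FG dν − ∫(P_xF)(P_xG) dν| ≤ a_xb_x∕c_x`).
* §2 THE END **`abs_cov_le_kernel_gibbs`** (`|∫FG dν − ∫F dν∫G dν| ≤ Σ_w (Dᵀa)_w(Dᵀb)_w∕c_w`).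
* §3 the kernel letter: `bilinear_rowsum_le` (pure: `Σ_y Σ_w (Dᵀa)_w(Dᵀb^y)_w∕c_w ≤ (Σa)κc·dr·dc∕cmin`), **`cov_rowsum_le_gibbs`**
  (`Σ_{y∈S} |Cov_ν(F,G_y)| ≤ (Σ_za_z)·κc·dr·dc∕cmin` for any finset `S` of indices and family with `Σ_{y∈S} b^y_z ≤ κc`).
* §4 toy: none beyond (440)–(446) (every hypothesis is a letter; the road instance (449) supplies them).

HONEST (what this is NOT).  The matrix `D` is an INPUT here (any nonnegative `D` with `I + D·C ≤ D`); its Neumann-series construction with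
row∕column letters `1∕(1−γ)`, `1∕(1−γ′)` is (448); the road instance (`V = ½ω·Γ⁻¹ω + U(ω+ψ)` of (399)–(439), giving the letter for (439)'s
`Σ_y|C_{xy}(ψ)|`) is (449).  Scalar skeleton ((A3), NC-NE7b-α UNRULED); nothing of Bałaban's asserted.  BY-NAME EFFECT ON THE WALL: NONE.
NE7b NOT PRINTED ∕ NOT PROVED; spine PROVED 0∕9; rung (B)+1 — the programme's measures remain FINITE-torus statements; NOT the mass gap,
NOT Clay.  HONEST DEPENDENCY: continuum YM on T⁴ ⇐ BetaPertH ∧ nine spine estimates (0∕9 proved); BetaPertH ⇐ (D1) ∧ (D4) ∧ CAP+tail;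
G-an2-4 gates asym, D1 and NE2∕3∕4.
-/

set_option autoImplicit false

noncomputable section

namespace Summit.QuantumFields.BalabanUV.T4Continuum.NE7b.SupDobrushinCovarianceGibbs

open MeasureTheory Real Set Function Finset
open scoped BigOperators
open SupOneSiteResamplingInvariance (resample_integral resample_cov_step memLp_coord_tilted)
open SupOneSiteResampling (resample_lipVec)
open SupDobrushinCovarianceAbstract (abs_cov_le_kernel)

variable {ι : Type} [Fintype ι] [DecidableEq ι]

variable {V : (ι → ℝ) → ℝ} {V₁ : ι → (ι → ℝ) → ℝ} {c : ι → ℝ} {Cw γ : ℝ} {J D : ι → ι → ℝ}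
  {P : ι → ((ι → ℝ) → ℝ) → ((ι → ℝ) → ℝ)} {F G : (ι → ℝ) → ℝ} {a b : ι → ℝ}

/-! ## §1. The Gibbs probability law and the sampler's hypotheses for it -/

omit [DecidableEq ι] in
/-- **Integrals against the Gibbs law**: `∫g dν = ∫g·e^{−V} ∕ ∫e^{−V}` for `ν = volume.tilted (−V)`. [folklore] -/
theorem integral_tilted_eq (g : (ι → ℝ) → ℝ) :
    ∫ ω, g ω ∂((volume : Measure (ι → ℝ)).tilted fun ω => -V ω) = (∫ ω, g ω * exp (-V ω)) / ∫ ω, exp (-V ω) := by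
  rw [integral_tilted, ← integral_div]
  refine integral_congr_ae (ae_of_all _ fun ω => ?_)
  simp only [smul_eq_mul]
  ring

/-- **(P2) for the Gibbs law**: `∫(P_xF) dν = ∫F dν`. [folklore] -/
theorem resample_integral_tilted
    (hP : ∀ x F ω, P x F ω = (∫ s, F (update ω x s) * exp (-V (update ω x s))) / ∫ s, exp (-V (update ω x s)))
    (hV : ∀ x ω, HasDerivAt (fun s => V (update ω x s)) (V₁ x ω) (ω x))
    (hfloor : ∀ x ω s t, c x * (s - t) ^ 2 ≤ (V₁ x (update ω x s) - V₁ x (update ω x t)) * (s - t)) (hc : ∀ x, 0 < c x)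
    (hceil : ∀ x ω s t, |V₁ x (update ω x s) - V₁ x (update ω x t)| ≤ Cw * |s - t|)
    (hcross : ∀ x z, z ≠ x → ∀ ω s t, |V₁ x (update ω z s) - V₁ x (update ω z t)| ≤ J x z * |s - t|) (hVc : Continuous V)
    (hV0 : Integrable (fun ω : ι → ℝ => exp (-V ω))) (hV2 : ∀ z, Integrable (fun ω : ι → ℝ => ω z ^ 2 * exp (-V ω))) (x : ι)
    (F : (ι → ℝ) → ℝ) (a : ι → ℝ) (hF : ∀ z ω s t, |F (update ω z s) - F (update ω z t)| ≤ a z * |s - t|) :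
    ∫ ω, P x F ω ∂((volume : Measure (ι → ℝ)).tilted fun ω => -V ω) = ∫ ω, F ω ∂((volume : Measure (ι → ℝ)).tilted fun ω => -V ω) := by
  rw [integral_tilted_eq, integral_tilted_eq, resample_integral hP hV hfloor hc hceil hcross hVc hV0 hV2 x hF]

/-- **(P3) for the Gibbs law**: `|∫FG dν − ∫(P_xF)(P_xG) dν| ≤ a_xb_x∕c_x`. [folklore] -/
theorem resample_cov_step_tilted
    (hP : ∀ x F ω, P x F ω = (∫ s, F (update ω x s) * exp (-V (update ω x s))) / ∫ s, exp (-V (update ω x s)))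
    (hV : ∀ x ω, HasDerivAt (fun s => V (update ω x s)) (V₁ x ω) (ω x))
    (hfloor : ∀ x ω s t, c x * (s - t) ^ 2 ≤ (V₁ x (update ω x s) - V₁ x (update ω x t)) * (s - t)) (hc : ∀ x, 0 < c x)
    (hceil : ∀ x ω s t, |V₁ x (update ω x s) - V₁ x (update ω x t)| ≤ Cw * |s - t|)
    (hcross : ∀ x z, z ≠ x → ∀ ω s t, |V₁ x (update ω z s) - V₁ x (update ω z t)| ≤ J x z * |s - t|) (hVc : Continuous V)
    (hV0 : Integrable (fun ω : ι → ℝ => exp (-V ω))) (hV2 : ∀ z, Integrable (fun ω : ι → ℝ => ω z ^ 2 * exp (-V ω))) (x : ι)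
    (F G : (ι → ℝ) → ℝ) (a b : ι → ℝ) (hF : ∀ z ω s t, |F (update ω z s) - F (update ω z t)| ≤ a z * |s - t|)
    (hG : ∀ z ω s t, |G (update ω z s) - G (update ω z t)| ≤ b z * |s - t|) :
    |∫ ω, F ω * G ω ∂((volume : Measure (ι → ℝ)).tilted fun ω => -V ω) -
        ∫ ω, P x F ω * P x G ω ∂((volume : Measure (ι → ℝ)).tilted fun ω => -V ω)| ≤ a x * b x / c x := by
  have hZ : 0 < ∫ ω : ι → ℝ, exp (-V ω) := integral_exp_pos hV0
  have h := resample_cov_step hP hV hfloor hc hceil hcross hVc hV0 hV2 x hF hG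
  rw [integral_tilted_eq, integral_tilted_eq, ← sub_div, abs_div, abs_of_pos hZ, div_le_iff₀ hZ]
  exact h

/-! ## §2. The covariance estimate -/

/-- **DOBRUSHIN'S COVARIANCE ESTIMATE FOR THE GIBBS LAW `ν ∝ e^{−V}dω` ON `ℝ^ι`**: under coordinate-line `C¹` regularity of `V` with
diagonal floor `c > 0` and a ceiling, cross letters `J ≥ 0` (`J_{xx} = 0`), row-diagonal dominance `Σ_zJ_{xz}∕c_x ≤ γ < 1`, continuity and
the moment letters, two observables with coordinate-Lipschitz vectors `a, b` satisfy, for every nonnegative `D` with `I + D·C ≤ D`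
(`C_{xz} = J_{xz}∕c_x`), `|∫FG dν − ∫F dν·∫G dν| ≤ Σ_w (Σ_zD_{zw}a_z)(Σ_zD_{zw}b_z)∕c_w`. [folklore: Föllmer 1982 ∕ LNM 1362 Thm (2.23)] -/
theorem abs_cov_le_kernel_gibbs
    (hP : ∀ x F ω, P x F ω = (∫ s, F (update ω x s) * exp (-V (update ω x s))) / ∫ s, exp (-V (update ω x s)))
    (hV : ∀ x ω, HasDerivAt (fun s => V (update ω x s)) (V₁ x ω) (ω x))
    (hfloor : ∀ x ω s t, c x * (s - t) ^ 2 ≤ (V₁ x (update ω x s) - V₁ x (update ω x t)) * (s - t)) (hc : ∀ x, 0 < c x)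
    (hceil : ∀ x ω s t, |V₁ x (update ω x s) - V₁ x (update ω x t)| ≤ Cw * |s - t|)
    (hcross : ∀ x z, z ≠ x → ∀ ω s t, |V₁ x (update ω z s) - V₁ x (update ω z t)| ≤ J x z * |s - t|) (hVc : Continuous V)
    (hV0 : Integrable (fun ω : ι → ℝ => exp (-V ω))) (hV2 : ∀ z, Integrable (fun ω : ι → ℝ => ω z ^ 2 * exp (-V ω)))
    (hJ : ∀ x z, 0 ≤ J x z) (hJ0 : ∀ x, J x x = 0) (hrow : ∀ x, ∑ z, J x z / c x ≤ γ) (hγ0 : 0 ≤ γ) (hγ1 : γ < 1)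
    (hD : ∀ x y, 0 ≤ D x y) (hDC : ∀ x y, (if x = y then (1 : ℝ) else 0) + ∑ z, D x z * (J z y / c z) ≤ D x y)
    (hF : ∀ z ω s t, |F (update ω z s) - F (update ω z t)| ≤ a z * |s - t|)
    (hG : ∀ z ω s t, |G (update ω z s) - G (update ω z t)| ≤ b z * |s - t|) :
    |∫ ω, F ω * G ω ∂((volume : Measure (ι → ℝ)).tilted fun ω => -V ω) -
        (∫ ω, F ω ∂((volume : Measure (ι → ℝ)).tilted fun ω => -V ω)) * (∫ ω, G ω ∂((volume : Measure (ι → ℝ)).tilted fun ω => -V ω))| ≤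
      ∑ w, (∑ z, D z w * a z) * (∑ z, D z w * b z) / c w := by
  set ν : Measure (ι → ℝ) := (volume : Measure (ι → ℝ)).tilted fun ω => -V ω with hν
  haveI : IsProbabilityMeasure ν := isProbabilityMeasure_tilted hV0
  have hμ2 : ∀ z, MemLp (fun ω : ι → ℝ => ω z) 2 ν := memLp_coord_tilted hV0 hV2
  -- the second-moment letter `M₂ = Σ_z ∫ω_z² dν`
  have hM : ∀ z, ∫ ω, ω z ^ 2 ∂ν ≤ ∑ y, ∫ ω, ω y ^ 2 ∂ν := fun z =>
    Finset.single_le_sum (f := fun y => ∫ ω : ι → ℝ, ω y ^ 2 ∂ν) (fun y _ => integral_nonneg fun ω : ι → ℝ => sq_nonneg (ω y))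
      (Finset.mem_univ z)
  -- (440)'s update with Dobrushin's matrix `C_{xz} = J_{xz}/c_x`
  have hA : ∀ (x : ι) (v : ι → ℝ) (z : ι), (fun (x : ι) (v : ι → ℝ) (z : ι) => if z = x then 0 else v z + J x z / c x * v x) x v z =
      if z = x then 0 else v z + (fun x z => J x z / c x) x z * v x := fun _ _ _ => rfl
  have hC : ∀ x z, 0 ≤ (fun x z => J x z / c x) x z := fun x z => div_nonneg (hJ x z) (hc x).le
  have hC0 : ∀ x, (fun x z => J x z / c x) x x = 0 := fun x => by simp [hJ0 x]
  have hrow' : ∀ x, ∑ z, (fun x z => J x z / c x) x z ≤ γ := hrow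
  have hDC' : ∀ x y, (if x = y then (1 : ℝ) else 0) + ∑ z, D x z * (fun x z => J x z / c x) z y ≤ D x y := hDC
  exact abs_cov_le_kernel (μ := ν) (P := P) hA hC hC0 hrow' hγ0 hγ1 hc hD hDC' hμ2 hM
    (fun x F a hF => resample_lipVec hP hV hfloor hc hceil hcross x F a hF)
    (fun x F a hF => resample_integral_tilted hP hV hfloor hc hceil hcross hVc hV0 hV2 x F a hF)
    (fun x F G a b hF hG => resample_cov_step_tilted hP hV hfloor hc hceil hcross hVc hV0 hV2 x F G a b hF hG) hF hG

/-! ## §3. The kernel (row-sum) letter for a family of observables -/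

omit [DecidableEq ι] in
/-- **Pure bookkeeping**: with row letter `Σ_wD_{zw} ≤ dr`, column letter `Σ_zD_{zw} ≤ dc`, floor `c_w ≥ cmin > 0`, a vector `a ≥ 0`
and a family `b^y ≥ 0` (`y ∈ S`) with summable columns `Σ_{y∈S} b^y_z ≤ κc`:
`Σ_{y∈S} Σ_w (Dᵀa)_w(Dᵀb^y)_w∕c_w ≤ (Σ_za_z)·κc·dr·dc∕cmin`. [folklore] -/
theorem bilinear_rowsum_le {κ : Type*} (S : Finset κ) {bf : κ → ι → ℝ} {dr dc cmin κc : ℝ} (hD : ∀ x y, 0 ≤ D x y)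
    (hDr : ∀ z, ∑ w, D z w ≤ dr) (hDc : ∀ w, ∑ z, D z w ≤ dc) (hcmin : 0 < cmin) (hc : ∀ w, cmin ≤ c w) (ha : ∀ z, 0 ≤ a z)
    (hb : ∀ y z, 0 ≤ bf y z) (hbc : ∀ z, ∑ y ∈ S, bf y z ≤ κc) :
    ∑ y ∈ S, ∑ w, (∑ z, D z w * a z) * (∑ z, D z w * bf y z) / c w ≤ (∑ z, a z) * κc * dr * dc / cmin := by
  rcases isEmpty_or_nonempty ι with hι | ⟨⟨w₀⟩⟩
  · simp
  have hdr : 0 ≤ dr := (Finset.sum_nonneg fun w _ => hD w₀ w).trans (hDr w₀)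
  have hκc : 0 ≤ κc := (Finset.sum_nonneg fun y _ => hb y w₀).trans (hbc w₀)
  have hdc : 0 ≤ dc := (Finset.sum_nonneg fun z _ => hD z w₀).trans (hDc w₀)
  have hα : ∀ w, 0 ≤ ∑ z, D z w * a z := fun w => Finset.sum_nonneg fun z _ => mul_nonneg (hD z w) (ha z)
  -- the family's columns against `D`: `Σ_{y∈S} (Dᵀb^y)_w ≤ κc·dc`
  have hβ : ∀ w, ∑ y ∈ S, ∑ z, D z w * bf y z ≤ κc * dc := fun w => by
    rw [Finset.sum_comm]
    calc ∑ z, ∑ y ∈ S, D z w * bf y z = ∑ z, D z w * ∑ y ∈ S, bf y z :=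
          Finset.sum_congr rfl fun z _ => by rw [Finset.mul_sum]
      _ ≤ ∑ z, D z w * κc := Finset.sum_le_sum fun z _ => mul_le_mul_of_nonneg_left (hbc z) (hD z w)
      _ = κc * ∑ z, D z w := by rw [← Finset.sum_mul]; ring
      _ ≤ κc * dc := mul_le_mul_of_nonneg_left (hDc w) hκc
  have hβ0 : ∀ w, 0 ≤ ∑ y ∈ S, ∑ z, D z w * bf y z := fun w =>
    Finset.sum_nonneg fun y _ => Finset.sum_nonneg fun z _ => mul_nonneg (hD z w) (hb y z)
  calc ∑ y ∈ S, ∑ w, (∑ z, D z w * a z) * (∑ z, D z w * bf y z) / c w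
      = ∑ w, (∑ z, D z w * a z) / c w * ∑ y ∈ S, ∑ z, D z w * bf y z := by
        rw [Finset.sum_comm]
        refine Finset.sum_congr rfl fun w _ => ?_
        rw [Finset.mul_sum]
        exact Finset.sum_congr rfl fun y _ => by ring
    _ ≤ ∑ w, (∑ z, D z w * a z) / cmin * (κc * dc) := Finset.sum_le_sum fun w _ =>
        mul_le_mul (div_le_div_of_nonneg_left (hα w) hcmin (hc w)) (hβ w) (hβ0 w) (div_nonneg (hα w) hcmin.le)
    _ = (κc * dc / cmin) * ∑ z, a z * ∑ w, D z w := by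
        rw [Finset.mul_sum]
        have e : ∀ z, κc * dc / cmin * (a z * ∑ w, D z w) = ∑ w, κc * dc / cmin * (D z w * a z) := fun z => by
          rw [Finset.mul_sum, Finset.mul_sum]
          exact Finset.sum_congr rfl fun w _ => by ring
        simp_rw [e]
        rw [Finset.sum_comm]
        refine Finset.sum_congr rfl fun w _ => ?_
        rw [div_mul_eq_mul_div, Finset.sum_mul, Finset.sum_div]
        exact Finset.sum_congr rfl fun z _ => by ring
    _ ≤ (κc * dc / cmin) * ∑ z, a z * dr :=
        mul_le_mul_of_nonneg_left (Finset.sum_le_sum fun z _ => mul_le_mul_of_nonneg_left (hDr z) (ha z)) (by positivity)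
    _ = (∑ z, a z) * κc * dr * dc / cmin := by rw [← Finset.sum_mul]; ring

/-- **THE KERNEL LETTER — ROW SUMS OF A COVARIANCE KERNEL UNDER THE GIBBS LAW**: for `F` with vector `a` and a family `G_y` (`y ∈ S`) with
vectors `b^y` whose columns are summable (`Σ_{y∈S} b^y_z ≤ κc`), under the hypotheses of `abs_cov_le_kernel_gibbs` and the letters
`Σ_wD_{zw} ≤ dr`, `Σ_zD_{zw} ≤ dc`, `c_w ≥ cmin > 0`:  `Σ_{y∈S} |∫FG_y dν − ∫F dν∫G_y dν| ≤ (Σ_za_z)·κc·dr·dc∕cmin`. [folklore] -/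
theorem cov_rowsum_le_gibbs {κ : Type*} (S : Finset κ) {Gf : κ → (ι → ℝ) → ℝ} {bf : κ → ι → ℝ} {dr dc cmin κc : ℝ}
    (hP : ∀ x F ω, P x F ω = (∫ s, F (update ω x s) * exp (-V (update ω x s))) / ∫ s, exp (-V (update ω x s)))
    (hV : ∀ x ω, HasDerivAt (fun s => V (update ω x s)) (V₁ x ω) (ω x))
    (hfloor : ∀ x ω s t, c x * (s - t) ^ 2 ≤ (V₁ x (update ω x s) - V₁ x (update ω x t)) * (s - t)) (hc : ∀ x, 0 < c x)
    (hceil : ∀ x ω s t, |V₁ x (update ω x s) - V₁ x (update ω x t)| ≤ Cw * |s - t|)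
    (hcross : ∀ x z, z ≠ x → ∀ ω s t, |V₁ x (update ω z s) - V₁ x (update ω z t)| ≤ J x z * |s - t|) (hVc : Continuous V)
    (hV0 : Integrable (fun ω : ι → ℝ => exp (-V ω))) (hV2 : ∀ z, Integrable (fun ω : ι → ℝ => ω z ^ 2 * exp (-V ω)))
    (hJ : ∀ x z, 0 ≤ J x z) (hJ0 : ∀ x, J x x = 0) (hrow : ∀ x, ∑ z, J x z / c x ≤ γ) (hγ0 : 0 ≤ γ) (hγ1 : γ < 1)
    (hD : ∀ x y, 0 ≤ D x y) (hDC : ∀ x y, (if x = y then (1 : ℝ) else 0) + ∑ z, D x z * (J z y / c z) ≤ D x y)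
    (hDr : ∀ z, ∑ w, D z w ≤ dr) (hDc : ∀ w, ∑ z, D z w ≤ dc) (hcmin : 0 < cmin) (hcm : ∀ w, cmin ≤ c w)
    (hF : ∀ z ω s t, |F (update ω z s) - F (update ω z t)| ≤ a z * |s - t|)
    (hGf : ∀ y z ω s t, |Gf y (update ω z s) - Gf y (update ω z t)| ≤ bf y z * |s - t|) (hbc : ∀ z, ∑ y ∈ S, bf y z ≤ κc) :
    ∑ y ∈ S, |∫ ω, F ω * Gf y ω ∂((volume : Measure (ι → ℝ)).tilted fun ω => -V ω) -
        (∫ ω, F ω ∂((volume : Measure (ι → ℝ)).tilted fun ω => -V ω)) *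
          (∫ ω, Gf y ω ∂((volume : Measure (ι → ℝ)).tilted fun ω => -V ω))| ≤ (∑ z, a z) * κc * dr * dc / cmin := by
  have ha : ∀ z, 0 ≤ a z := SupCoordinateLipschitzClass.lipVec_nonneg hF
  have hb : ∀ y z, 0 ≤ bf y z := fun y => SupCoordinateLipschitzClass.lipVec_nonneg (hGf y)
  refine le_trans (Finset.sum_le_sum fun y _ => abs_cov_le_kernel_gibbs hP hV hfloor hc hceil hcross hVc hV0 hV2 hJ hJ0 hrow hγ0 hγ1
    hD hDC hF (hGf y)) ?_
  exact bilinear_rowsum_le S hD hDr hDc hcmin hcm ha hb hbc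

end Summit.QuantumFields.BalabanUV.T4Continuum.NE7b.SupDobrushinCovarianceGibbs

end
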